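import Mathlib
import Summits.NavierStokesRegularity.NavierStokesRegularity.Theorems.DssFarFieldSlavingBlowupTypeIDssProfileSimilarityEnstrophyHardyThreshold
import Summits.NavierStokesRegularity.NavierStokesRegularity.Theorems.DssFarFieldSlavingBlowupTypeIDssProfileSimilarityEnstrophyTimeThreshold
import Literature.Analysis.FluidPDE.TypeIAncientMildDecay
import HarnessLib

/-!
# E29 and E3′(time) at CLASS level, UNCONDITIONALLY: the named decay input (D) discharged from the tree
  (pub-ns-dss T38-SCOPE; route `DssFarFieldSlaving`, crux `BlowupTypeIDssProfile`,
  stmt-NavierStokesRegularity-0155 — SUPPORT, LABEL-BEARING; typer seat g7, 2026-08-23; lead A231 (2) /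
  A234 / A237; composition = theory g10 `T38-Discharge-Statements.lean` v2 3af9dde959a1cf73 and lit g10's
  tree finding INBOX l.1654, now the Literature theorem
  `Literature.Analysis.FluidPDE.IsTypeIAncientMild.gaugeBounds_of_hasTypeIDecay` (p365047))

HONEST FRAMING. Exclusion statements about a HYPOTHETICAL object (a member of the rotated-DSS Type-I
class / a KNSS-gauge Type-I field with the space–time Type-I envelope). The class wrappers
`rdssClass_hardyStretching_empty` (E29: Hardy-weighted stretching threshold `¼`, p363097) and
`rdssClass_empty_of_decay_of_typeI_lt_one` (E3′(time): `M < 1`, p363433) were landed CONDITIONAL on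
ONE named input `hD` = (D): for every KNSS-gauge Type-I field with the envelope `HasTypeIDecay M V`,
the scale-invariant gauge bounds `(‖x‖ + √(−t))^{k+1} ‖DᵏV(t,x)‖ ≤ C_k`, `k = 1, 2, 3`. That input is
now a THEOREM of the Literature layer, `IsTypeIAncientMild.gaugeBounds_of_hasTypeIDecay` — Pineau–Vicol
2026 Lemma 7.1 (7.2) = Chae–Wolf 2017 (3.6) as formalised class-uniformly
(`PineauVicol2026.exists_forall_iteratedFDeriv_le_of_typeI`, quantitative interior regularity on unit
parabolic cylinders, pre-cell Literature) applied to the global classical representative of a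
KNSS-gauge field — so both class statements hold with NO hypothesis beyond the class. Census words on
ACCEPT are the lead's (pre-stated PLAN A231 / A237 (c)). Mechanisms unchanged (unweighted similarity
enstrophy; DSS-blind: `c`, `R`, `IsRotatedDSS` discarded). Nothing numeric about any candidate; nothing
here bears on Navier–Stokes regularity or blow-up.
[cite: ChaeWolf2017RemovingDSS, §3 eq. (3.6) (arXiv:1610.09464 p. 8)]
[cite: PineauVicol2026, Lemma 7.1, proof, eq. (7.2) (arXiv:2607.09619 p. 24)]
-/

noncomputable section

set_option linter.dupNamespace false

namespace Summit.NavierStokesRegularity.NavierStokesRegularity.Theorems.SimilarityEnstrophy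

open MeasureTheory Set Filter Topology InnerProductSpace Function
open scoped RealInnerProductSpace ContDiff
open Literature.Analysis Literature.Analysis.FluidPDE
open Summit.NavierStokesRegularity.NavierStokesRegularity.Theorems

/-- **E29 at CLASS level, UNCONDITIONAL** (theory (4b)): NO member of the hypothesis class of
`RdssProfileTruncation` — any Type-I constant `M`, any factor `c > 1`, ANY twist `R ∈ O(3)` — has all
its smooth Type-I representatives satisfying the Hardy-weighted stretching threshold
`‖x − x₀‖²⟪∇V ω, ω⟫ ≤ ¼‖ω‖²` about some centre: `rdssClass_hardyStretching_empty` with its input `hD`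
DISCHARGED by the tree's `IsTypeIAncientMild.gaugeBounds_of_hasTypeIDecay`. DSS-blind.
[this file; census words on ACCEPT are the lead's (A231); nothing numerical is asserted and nothing
here bears on NS regularity] -/
theorem rdssClass_hardyStretching_empty_unconditional (M : ℝ) :
    ¬ ∃ (c : ℝ) (R : (EuclideanSpace ℝ (Fin 3)) ≃ₗᵢ[ℝ] (EuclideanSpace ℝ (Fin 3)))
        (u : ℝ → (EuclideanSpace ℝ (Fin 3)) → (EuclideanSpace ℝ (Fin 3))),
      1 < c ∧ IsAncientMildSolution 1 u ∧ (∀ t < 0, AEStronglyMeasurable (u t) volume) ∧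
      IsRotatedDSS c R u ∧ HasTypeIDecay M u ∧
      (∀ V : ℝ → EuclideanSpace ℝ (Fin 3) → EuclideanSpace ℝ (Fin 3), IsTypeIAncientMild M V →
        (∀ t < 0, V t =ᵐ[volume] u t) →
        ∃ x₀ : EuclideanSpace ℝ (Fin 3), ∀ t < 0, ∀ x,
          ‖x - x₀‖ ^ 2 * ⟪fderiv ℝ (V t) x (curl (V t) x), curl (V t) x⟫ ≤
            (1 / 4) * ‖curl (V t) x‖ ^ 2) ∧
      ¬ (∀ t < 0, u t =ᵐ[volume] 0) :=
  rdssClass_hardyStretching_empty IsTypeIAncientMild.gaugeBounds_of_hasTypeIDecay M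

/-- **E3′(time) at CLASS level for EVERY `M < 1`, UNCONDITIONAL** (theory (4c) = (3c) verbatim): the
hypothesis class of `RdssProfileTruncation` (any `c > 1`, ANY twist `R ∈ O(3)`) is EMPTY for every
space–time Type-I constant `M < 1`: `rdssClass_empty_of_decay_of_typeI_lt_one` with `hD` DISCHARGED by
the tree's `IsTypeIAncientMild.gaugeBounds_of_hasTypeIDecay`; equivalently the tree's conditional
wrappers `ExplicitThreshold.rdssClass_empty_of_explicitTimeThreshold` / `…_of_timeOnlyThreshold` with
their T31″ hypothesis discharged. DSS-blind. [this file; census words on ACCEPT are the lead's (A231);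
nothing numerical is asserted and nothing here bears on NS regularity] -/
theorem rdssClass_empty_of_typeI_lt_one {M : ℝ} (hM : M < 1) :
    ¬ ∃ (c : ℝ) (R : (EuclideanSpace ℝ (Fin 3)) ≃ₗᵢ[ℝ] (EuclideanSpace ℝ (Fin 3)))
        (u : ℝ → (EuclideanSpace ℝ (Fin 3)) → (EuclideanSpace ℝ (Fin 3))),
      1 < c ∧ IsAncientMildSolution 1 u ∧ (∀ t < 0, AEStronglyMeasurable (u t) volume) ∧
      IsRotatedDSS c R u ∧ HasTypeIDecay M u ∧ ¬ (∀ t < 0, u t =ᵐ[volume] 0) :=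
  rdssClass_empty_of_decay_of_typeI_lt_one IsTypeIAncientMild.gaugeBounds_of_hasTypeIDecay hM

/-- **T31″ at CLASSICAL level for the space–time Type-I class, UNCONDITIONAL** (theory (4d)): a
KNSS-gauge Type-I field with the envelope `HasTypeIDecay M V` and `M < 1` vanishes —
`typeI_ancient_eq_zero_of_typeI_lt_one` with (D₁)–(D₃) supplied by the tree's
`IsTypeIAncientMild.gaugeBounds_of_hasTypeIDecay`. [this file; nothing here bears on NS regularity] -/
theorem typeI_ancient_eq_zero_of_hasTypeIDecay_lt_one {M : ℝ}
    {V : ℝ → EuclideanSpace ℝ (Fin 3) → EuclideanSpace ℝ (Fin 3)}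
    (hM : M < 1) (hV : IsTypeIAncientMild M V) (hdec : HasTypeIDecay M V) :
    ∀ t < 0, ∀ x, V t x = 0 := by
  obtain ⟨C₁, C₂, C₃, hD1, hD2, hD3⟩ := IsTypeIAncientMild.gaugeBounds_of_hasTypeIDecay hV hdec
  exact typeI_ancient_eq_zero_of_typeI_lt_one hM hV hD1 hD2 hD3

end Summit.NavierStokesRegularity.NavierStokesRegularity.Theorems.SimilarityEnstrophy
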